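import Literature.Geometry.Lorentzian.SchwarzschildKerrSchildKoszul
import HarnessLib

/-!
# The Schwarzschild metric in ingoing Kerr–Schild Cartesian coordinates, III: an orthonormal frame
# adapted to a point, and the Gram matrix of the metric in it

Support file (all results proved) for `Kerr.isRicciFlat M 0 r₀`
(`SchwarzschildKerrSchildRicciFlat.lean`):

* `Schwarzschild.exists_orthonormalBasis_adapted` — an orthonormal basis `c` of `E4` with
  `c 0 = ∂₀` and `c 3 = n♯ = (0, x⃗/r)` at a point off the time axis, and the values of the atoms
  `ℓ, ν, P, ∂ℓ, ∂P` of `SchwarzschildKerrSchildComponents.lean` on it (`ell_frame`, `nu_frame`,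
  `proj_frame`, `dEll_frame`, `dProj_frame`: Kronecker deltas in the frame indices);
* `Schwarzschild.gram_frame_inv` — in this frame the Gram matrix of `g_{M,0}` is
  `[[−1+F, 0, 0, F], [0, 1, 0, 0], [0, 0, 1, 0], [F, 0, 0, 1+F]]`, `F = 2M/r`, with determinant `−1`
  and inverse `Schwarzschild.ginvMat = [[−(1+F), 0, 0, F], [0, 1, 0, 0], [0, 0, 1, 0], [F, 0, 0, 1−F]]`
  (Kerr–Schild 1965, §2: Kerr–Schild coordinates are unimodular).

## References

* R. P. Kerr, A. Schild, *A new class of vacuum solutions of the Einstein field equations* (1965),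
  §2.
* B. O'Neill, *Semi-Riemannian geometry* (1983), Ch. 3, Lemma 3.38, Lemma 3.52.
* M. Visser, *The Kerr spacetime: a brief introduction*, arXiv:0706.0622, (32)–(34).
-/

noncomputable section

set_option maxSynthPendingDepth 3

open Bundle TopologicalSpace Manifold Set Module Filter
open scoped ContDiff Topology InnerProductSpace

namespace Literature.Geometry.Lorentzian

namespace Schwarzschild

/-! ### An orthonormal frame of `E4` adapted to a point off the time axis -/

/-- The **unit radial vector** `n♯ = (0, x⃗/r)` at a point `x` off the time axis. [folklore] -/
def radialVector (x : E4) : E4 := E4.ofTimeSpace 0 ((E4.spatialNorm x)⁻¹ • E4.spatial x)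

/-- `(n♯)⁰ = 0`. [folklore] -/
@[simp]
theorem radialVector_apply_zero (x : E4) : radialVector x 0 = 0 := rfl

/-- `n♯⃗ = x⃗ / r`. [folklore] -/
@[simp]
theorem spatial_radialVector (x : E4) :
    E4.spatial (radialVector x) = (E4.spatialNorm x)⁻¹ • E4.spatial x := by
  simp [radialVector]

/-- The time component is the pairing with `∂₀`: `v⁰ = ⟪∂₀, v⟫`. [folklore] -/
theorem inner_basisVector_zero_left (v : E4) : ⟪E4.basisVector 0, v⟫_ℝ = v 0 := by
  rw [E4.basisVector, EuclideanSpace.inner_single_left]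
  simp

variable {x : E4}

/-- `⟪n♯, v⟫ = ⟪x⃗, v⃗⟫ / r`. [folklore] -/
theorem inner_radialVector_left (v : E4) :
    ⟪radialVector x, v⟫_ℝ = sdot x v / E4.spatialNorm x := by
  rw [Kerr.inner_eq_time_add_spatial, radialVector_apply_zero, zero_mul, zero_add,
    spatial_radialVector, real_inner_smul_left, sdot]
  ring

/-- **An orthonormal frame of `E4` adapted to `x`**: for `x⃗ ≠ 0` there is an orthonormal basis
`c` of `E4` (Euclidean structure) with `c 0 = ∂₀` and `c 3 = n♯ = (0, x⃗/r)`; then `c 1, c 2`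
are spatial unit vectors orthogonal to `x⃗`. [folklore] -/
theorem exists_orthonormalBasis_adapted (hx : E4.spatial x ≠ 0) :
    ∃ c : OrthonormalBasis (Fin 4) ℝ E4, c 0 = E4.basisVector 0 ∧ c 3 = radialVector x := by
  have hr : E4.spatialNorm x ≠ 0 := by rwa [E4.spatialNorm, norm_ne_zero_iff]
  set f : Fin 4 → E4 := fun k ↦ if k = 0 then E4.basisVector 0 else radialVector x with hf
  have hcard : finrank ℝ E4 = Fintype.card (Fin 4) := by simp
  have h00 : ‖E4.basisVector 0‖ = 1 := by
    simp [E4.basisVector]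
  have h03 : ⟪E4.basisVector 0, radialVector x⟫_ℝ = 0 := by
    rw [inner_basisVector_zero_left, radialVector_apply_zero]
  have h30 : ⟪radialVector x, E4.basisVector 0⟫_ℝ = 0 := by
    rw [real_inner_comm, h03]
  have h33 : ‖radialVector x‖ = 1 := by
    have h : ⟪radialVector x, radialVector x⟫_ℝ = 1 := by
      rw [inner_radialVector_left, sdot, spatial_radialVector, real_inner_smul_right,
        real_inner_self_eq_norm_sq, ← E4.spatialNorm]
      field_simp
    rw [real_inner_self_eq_norm_sq] at h
    nlinarith [norm_nonneg (radialVector x)]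
  have hv : Orthonormal ℝ (({0, 3} : Set (Fin 4)).restrict f) := by
    rw [orthonormal_iff_ite]
    rintro ⟨i, hi⟩ ⟨j, hj⟩
    simp only [Set.mem_insert_iff, Set.mem_singleton_iff] at hi hj
    rcases hi with rfl | rfl <;> rcases hj with rfl | rfl <;>
      simp [hf, h00, h03, h30, h33]
  obtain ⟨c, hc⟩ := Orthonormal.exists_orthonormalBasis_extension_of_card_eq hcard hv
  refine ⟨c, ?_, ?_⟩
  · rw [hc 0 (by simp)]; simp [hf]
  · rw [hc 3 (by simp)]; simp [hf]

/-! ### The atoms on the adapted frame -/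

/-- Time indicator `δ_{k0}` of a frame index. [folklore] -/
def tI (k : Fin 4) : ℝ := if k = 0 then 1 else 0

/-- Radial indicator `δ_{k3}` of a frame index. [folklore] -/
def rI (k : Fin 4) : ℝ := if k = 3 then 1 else 0

/-- Kronecker delta `δ_{kl}` of two frame indices. [folklore] -/
def dI (k l : Fin 4) : ℝ := if k = l then 1 else 0

section Frame

variable (hx : E4.spatial x ≠ 0) (c : OrthonormalBasis (Fin 4) ℝ E4)
  (hc0 : c 0 = E4.basisVector 0) (hc3 : c 3 = radialVector x)

include hc0 in
/-- In the adapted frame the time components are `(c k)⁰ = δ_{k0}`. [folklore] -/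
theorem frame_apply_zero (k : Fin 4) : c k 0 = tI k := by
  rw [← inner_basisVector_zero_left, ← hc0, c.inner_eq_ite, tI]
  by_cases h : k = 0
  · subst h; simp
  · simp [h, Ne.symm h]

include hx hc3 in
/-- In the adapted frame `⟪x⃗, (c k)⃗⟫ = r δ_{k3}`. [folklore] -/
theorem sdot_frame_left (k : Fin 4) : sdot x (c k) = E4.spatialNorm x * rI k := by
  have hr : E4.spatialNorm x ≠ 0 := by rwa [E4.spatialNorm, norm_ne_zero_iff]
  have h := inner_radialVector_left (x := x) (c k)
  rw [← hc3, c.inner_eq_ite] at h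
  rw [rI]
  by_cases hk : k = 3
  · subst hk
    simp only [if_true] at h ⊢
    field_simp at h
    linarith
  · simp only [hk, Ne.symm hk, if_false] at h ⊢
    rw [eq_comm, div_eq_zero_iff] at h
    rcases h with h | h
    · rw [h]; ring
    · exact absurd h hr

include hc0 in
/-- In the adapted frame `⟪(c k)⃗, (c l)⃗⟫ = δ_{kl} − δ_{k0} δ_{l0}`. [folklore] -/
theorem sdot_frame (k l : Fin 4) : sdot (c k) (c l) = dI k l - tI k * tI l := by
  have h := Kerr.inner_eq_time_add_spatial (c k) (c l)
  rw [c.inner_eq_ite, frame_apply_zero c hc0, frame_apply_zero c hc0] at h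
  rw [sdot, dI]
  linarith

include hx hc0 hc3 in
/-- `ℓ(c k) = δ_{k0} + δ_{k3}`. [folklore] -/
theorem ell_frame (k : Fin 4) : ell x (c k) = tI k + rI k := by
  have hr : E4.spatialNorm x ≠ 0 := by rwa [E4.spatialNorm, norm_ne_zero_iff]
  rw [ell, sdot_frame_left hx c hc3, frame_apply_zero c hc0]
  field_simp

include hx hc3 in
/-- `ν(c k) = δ_{k3}`. [folklore] -/
theorem nu_frame (k : Fin 4) : nu x (c k) = rI k := by
  have hr : E4.spatialNorm x ≠ 0 := by rwa [E4.spatialNorm, norm_ne_zero_iff]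
  rw [nu, sdot_frame_left hx c hc3]
  field_simp

include hx hc0 hc3 in
/-- `P(c k, c l) = δ_{kl} − δ_{k0}δ_{l0} − δ_{k3}δ_{l3}`. [folklore] -/
theorem proj_frame (k l : Fin 4) : proj x (c k) (c l) = dI k l - tI k * tI l - rI k * rI l := by
  have hr : E4.spatialNorm x ≠ 0 := by rwa [E4.spatialNorm, norm_ne_zero_iff]
  rw [proj, sdot_frame c hc0, sdot_frame_left hx c hc3, sdot_frame_left hx c hc3]
  field_simp

include hx hc0 hc3 in
/-- `∂_{c i} ℓ(c k) = (δ_{ik} − δ_{i0}δ_{k0} − δ_{i3}δ_{k3}) / r`. [folklore] -/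
theorem dEll_frame (i k : Fin 4) :
    dEll x (c i) (c k) = (dI i k - tI i * tI k - rI i * rI k) / E4.spatialNorm x := by
  rw [dEll_eq, proj_frame hx c hc0 hc3]

include hx hc0 hc3 in
/-- `∂_{c i} P(c a, c b)` in the adapted frame. [folklore] -/
theorem dProj_frame (i a b : Fin 4) :
    dProj x (c i) (c a) (c b) =
      -((dI i a - tI i * tI a - rI i * rI a) * rI b + rI a * (dI i b - tI i * tI b - rI i * rI b)) /
        E4.spatialNorm x := by
  rw [dProj_eq, proj_frame hx c hc0 hc3, proj_frame hx c hc0 hc3, nu_frame hx c hc3,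
    nu_frame hx c hc3]

include hx hc0 hc3 in
/-- **The Schwarzschild components in the adapted frame**:
`g(c k, c l) = −δ_{k0}δ_{l0} + (δ_{kl} − δ_{k0}δ_{l0}) + (2M/r)(δ_{k0} + δ_{k3})(δ_{l0} + δ_{l3})`.
[cite: arXiv07060622, (32)–(34)] -/
theorem bilin_frame (M : ℝ) (k l : Fin 4) :
    Kerr.bilin M 0 x (c k) (c l) =
      -(tI k * tI l) + (dI k l - tI k * tI l) +
        2 * M / E4.spatialNorm x * ((tI k + rI k) * (tI l + rI l)) := by
  rw [bilin_zero_eq M hx, frame_apply_zero c hc0, frame_apply_zero c hc0, sdot_frame c hc0,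
    ell_frame hx c hc0 hc3, ell_frame hx c hc0 hc3]

include hx hc0 hc3 in
/-- **The Schwarzschild components in the adapted frame, entrywise**: with `F = 2M/r` the Gram
matrix `(g(c k, c l))` is `[[−1+F, 0, 0, F], [0, 1, 0, 0], [0, 0, 1, 0], [F, 0, 0, 1+F]]`.
[cite: arXiv07060622, (32)–(34)] -/
theorem bilin_frame_entry (M : ℝ) (k l : Fin 4) :
    Kerr.bilin M 0 x (c k) (c l) =
      !![-1 + 2 * M / E4.spatialNorm x, 0, 0, 2 * M / E4.spatialNorm x;
         0, 1, 0, 0;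
         0, 0, 1, 0;
         2 * M / E4.spatialNorm x, 0, 0, 1 + 2 * M / E4.spatialNorm x] k l := by
  rw [bilin_frame hx c hc0 hc3]
  clear hc0 hc3 hx
  fin_cases k <;> fin_cases l <;> simp [tI, rI, dI]

end Frame

/-- The explicit **inverse Gram matrix** of the Schwarzschild metric in an adapted frame,
`[[−(1+F), 0, 0, F], [0, 1, 0, 0], [0, 0, 1, 0], [F, 0, 0, 1−F]]` with `F = 2M/r`
(`gram_frame_inv`). [cite: KerrSchild1965, §2] -/
def ginvMat (M : ℝ) (x : E4) : Matrix (Fin 4) (Fin 4) ℝ :=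
  !![-(1 + 2 * M / E4.spatialNorm x), 0, 0, 2 * M / E4.spatialNorm x;
     0, 1, 0, 0;
     0, 0, 1, 0;
     2 * M / E4.spatialNorm x, 0, 0, 1 - 2 * M / E4.spatialNorm x]

/-- `det g = −1` in the adapted frame: `ginvMat` is a right inverse of the Gram matrix
(Kerr–Schild 1965, §2: Kerr–Schild coordinates are unimodular). [cite: KerrSchild1965, §2] -/
theorem gram_mul_ginvMat (M : ℝ) (x : E4) :
    !![-1 + 2 * M / E4.spatialNorm x, 0, 0, 2 * M / E4.spatialNorm x;
       0, 1, 0, 0;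
       0, 0, 1, 0;
       2 * M / E4.spatialNorm x, 0, 0, 1 + 2 * M / E4.spatialNorm x] * ginvMat M x =
      (1 : Matrix (Fin 4) (Fin 4) ℝ) := by
  ext k l
  fin_cases k <;> fin_cases l <;> simp [ginvMat, Matrix.mul_apply, Fin.sum_univ_four] <;> ring

/-- **The inverse Gram matrix of the Schwarzschild metric in an adapted frame** is `ginvMat M x`.
[cite: KerrSchild1965, §2] -/
theorem gram_frame_inv {x : E4} (hx : E4.spatial x ≠ 0) (c : OrthonormalBasis (Fin 4) ℝ E4)
    (hc0 : c 0 = E4.basisVector 0) (hc3 : c 3 = radialVector x) (M : ℝ) :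
    (Matrix.of fun k l ↦ Kerr.bilin M 0 x (c k) (c l))⁻¹ = ginvMat M x := by
  have h : (Matrix.of fun k l ↦ Kerr.bilin M 0 x (c k) (c l)) =
      !![-1 + 2 * M / E4.spatialNorm x, 0, 0, 2 * M / E4.spatialNorm x;
         0, 1, 0, 0;
         0, 0, 1, 0;
         2 * M / E4.spatialNorm x, 0, 0, 1 + 2 * M / E4.spatialNorm x] :=
    Matrix.ext fun k l ↦ bilin_frame_entry hx c hc0 hc3 M k l
  rw [h]
  exact Matrix.inv_eq_right_inv (gram_mul_ginvMat M x)

end Schwarzschild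

end Literature.Geometry.Lorentzian

end
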